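import Summits.QuantumFields.BalabanUV.Beta.FP.SliceTransportConjugation
import Summits.QuantumFields.BalabanUV.Beta.FP.SliceExchangeJets

/-!
# `BalabanUV.Beta.FP.ExponentialTransportJets` — road «FP» for binder row D1, ROUTE T, presentation T-β (W-FP-17-11 ∕ memo `N2B-DESIGN.md` §23 (23b)):
# **FOR ONE-PARAMETER-GROUP TRANSPORTS, (T-β-2) AND (T-β-3) ARE AUTOMATIC AND (T-β-4) IS FIRST-ORDER INTERTWINING; THE MOVED SLICE UN-MOVES FOR FREE**

WHAT.  The OWNER's conjugation-transport theorem (`SliceTransportConjugation` §1–§4, `SliceTransportConjugationEnd.secondVar_kkt_conj_transport`) carries, for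
field ∕ multiplier transports `A`, `Ā` with inverse `B`, five LETTERS: the inverse letters `b0 : B₀A₀ = 1`, `b1 : B₁A₀ + B₀A₁ = 0`,
`b2 : B₂A₀ + 2•(B₁A₁) + B₀A₂ = 0` (T-β-3) and jet-level unimodularity `uA : secondVar A₀ A₁ A₂ = 0`, `uĀ` (T-β-2); its conclusion lands on the MOVED slice
`τ·Bₙ`, whose Faddeev–Popov price `2·secondVar (τ·W₀) (τ·B₁·W₀) (τ·B₂·W₀)` (static generator `W₀`, `SliceExchangeJets`) vanishes only under an
INTERTWINING letter «`Bₙ·W₀ = W₀·Cₙ` with `secondVar C-jets = 0`» (T-β-4, the located sub-question Q-FP-17-3).  This module records the [folklore] fact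
that for transports which are ONE-PARAMETER GROUPS to second order — `A(u) = exp(uX)` (e.g. `Ad(exp(u·ψ))`, whatever the dictionary's colour-stripped
shadow `X` of `ad ψ` is), 2-jet `(A₀, A₁, A₂) = (1, X, X·X)` in the DERIVATIVE convention of `conj_kkt_second`'s `b2`, inverse 2-jet `(1, −X, X·X)` —
all of (T-β-2), (T-β-3) hold IDENTICALLY (§1), and (T-β-4) REDUCES TO FIRST ORDER: if the generator `X` preserves the gauge-mode subspace,
`X·W₀ = W₀·Z` (or only after slicing: `τ·X·W₀ = τ·W₀·Z`, `τ·X·X·W₀ = τ·W₀·Z·Z`), then `C = (1, −Z, Z·Z)` is itself an exponential jet, hence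
unimodular, and the moved-slice Faddeev–Popov 2-jet VANISHES (§2).  §3 composes §2 with the OWNER's slice exchange from 2-jets
(`SliceExchangeJets.secondVar_kkt_slice_change_jets_of_range`, relaxed Ward letters) in the STATIC frame of record (`W₁ = W₂ = 0`, TID-LETTER-SPEC § E):
**THE UN-MOVE** — the sliced 2-jet with the slice moved by the inverse exponential jet `(τ, τ·(−X), τ·(X·X))` has the SAME `secondVar` as the one with
the static slice `(τ, 0, 0)`; and the MOVING-GENERATOR twins (`secondVar_movedSlice_expJet_eq`, `secondVar_kkt_unmove_expJet_moving`): if `X`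
intertwines the generator JETS to first order (`X·W₀ = W₀·Z`, `X·W₁ = W₁·Z`) the moved-slice Faddeev–Popov 2-jet EQUALS the unmoved one, so the un-move is
free in any frame; and the GENERIC-TRANSPORT versions with memo §23 (23b)'s (T-β-4) AS LETTERS (`secondVar_movedSlice_eq_add_of_intertwine`,
`secondVar_movedSlice_eq_of_intertwine`, `secondVar_kkt_unmove_of_intertwine`: intertwining `i0 i1 i2 : (B·W)ₙ = (W·C)ₙ`, `uC : secondVar C₀ C₁ C₂ = 0`) — the exponential
case is `B = (1, −X, X·X)`, `C = (1, −Z, Z·Z)` with `uC` automatic.  NET for the (STEP) door (with `secondVar_kkt_conj_transport`, I-FP-17-11): the sliced 2-jet with STATIC slice `τ` is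
INVARIANT under exponential conjugation transport whose generator intertwines the gauge modes — ZERO Faddeev–Popov cost; the letters LEFT for the
dictionary are (T-β-1) (the tables' jets along `Π_big e_b` ARE the `X`-conjugated words of those along `Π_small e_b`) and the first-order intertwining
`X·W₀ = W₀·Z` (+ the non-degeneracies).  NOT HERE: what `X` is for the literal (an2 ∕ the OWNER's dictionary), any table identity, any estimate.

HONEST DEPENDENCY (page 1, mandatory): continuum YM on T⁴ ⇐ BetaPertH ∧ nine spine estimates (0/9 proved); BetaPertH ⇐ (D1) ∧ (D4) ∧ CAP+tail;
G-an2-4 gates asym, D1 and NE2/3/4.  HONEST FRAMING (cell contract, verbatim): «discharging `BetaPertH` makes Bałaban's UV stability UNCONDITIONAL —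
a real constructive-QFT result; it is NOT the continuum limit and NOT the Clay problem.»  ABSOLUTE RULE (cell charter, verbatim): «No internally-minted
statement may enter as a cited fact. Every hypothesis is either kernel-proved in this package or a verbatim quotation of a PUBLISHED theorem with page
reference. The manuscript(s) under audit are NOT citable for their own disputed steps — they are the thing under adjudication; programme-internal
(2001/route/tribunal) claims are never citable.»  [folklore] finite-matrix jet algebra over the OWNER's `secondVar_mul₂` and `secondVar_kkt_slice_change_jets_of_range`
and my lineage's `secondVar_zero_jets`; no `def`, no `def … : Prop`, nothing cited, 0 sorry; 0 estimates; 0∕4 row-D1 binders; NOT the dictionary, NOT (T-ID),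
NOT SDF, NOT D1, NOT BetaPertH, NOT continuum, NOT Clay.  «not in print; our bookkeeping».
Provenance: D1 formalisation swarm LEAF PROVER 06, unit b2b-balaban-beta-d1-formalise-leaf-06 gen 18, 2026-08-22.  No existing file touched.
-/

noncomputable section

namespace Summit.QuantumFields.BalabanUV.Beta.FP.ExponentialTransportJets

open Matrix
open Literature.MathematicalPhysics.QuantumFieldTheory.Balaban1983to89.Beta.Composition (kkt)
open Summit.QuantumFields.BalabanUV.Beta.D1BFx.LogDetSecondVariation (secondVar)
open Summit.QuantumFields.BalabanUV.Beta.FP.CombSliceJetLetters (secondVar_zero_jets)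
open Summit.QuantumFields.BalabanUV.Beta.FP.SliceTransportConjugation (secondVar_mul₂)
open Summit.QuantumFields.BalabanUV.Beta.FP.SliceExchangeJets (secondVar_kkt_slice_change_jets_of_range)

/-! ## §1 One-parameter-group 2-jets: the inverse letters (T-β-3) and jet-level unimodularity (T-β-2) hold identically -/

section Group

variable {ι : Type*} [Fintype ι] [DecidableEq ι]

/-- [folklore] inverse letter, order 0, for the exponential 2-jets `A = (1, X, X·X)`, `B = (1, −X, X·X)`: `B₀·A₀ = 1`. -/
theorem expJet_b0 : (1 : Matrix ι ι ℝ) * (1 : Matrix ι ι ℝ) = 1 :=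
  Matrix.mul_one _

/-- [folklore] inverse letter, order 1: `B₁·A₀ + B₀·A₁ = (−X)·1 + 1·X = 0`. -/
theorem expJet_b1 (X : Matrix ι ι ℝ) : -X * (1 : Matrix ι ι ℝ) + (1 : Matrix ι ι ℝ) * X = 0 := by
  rw [Matrix.mul_one, Matrix.one_mul, neg_add_cancel]

/-- [folklore] inverse letter, order 2 (derivative convention, the shape of `SliceTransportConjugation.conj_kkt_second`'s `b2`):
`B₂·A₀ + 2•(B₁·A₁) + B₀·A₂ = (X·X)·1 + 2•((−X)·X) + 1·(X·X) = 0`. -/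
theorem expJet_b2 (X : Matrix ι ι ℝ) :
    X * X * (1 : Matrix ι ι ℝ) + (2 : ℝ) • (-X * X) + (1 : Matrix ι ι ℝ) * (X * X) = 0 := by
  rw [Matrix.mul_one, Matrix.one_mul, Matrix.neg_mul, smul_neg, two_smul]
  abel

/-- [folklore] **JET-LEVEL UNIMODULARITY OF A ONE-PARAMETER GROUP**: `secondVar 1 X (X·X) = tr(X·X) − tr(X·X) = 0`
(`(log|det exp(uX)|)″ = (u·tr X)″ = 0`). -/
theorem secondVar_expJet (X : Matrix ι ι ℝ) : secondVar (1 : Matrix ι ι ℝ) X (X * X) = 0 := by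
  simp only [secondVar, inv_one, Matrix.one_mul, sub_self]

/-- [folklore] the same for the inverse jet `(1, −X, X·X)`. -/
theorem secondVar_expJet_neg (X : Matrix ι ι ℝ) : secondVar (1 : Matrix ι ι ℝ) (-X) (X * X) = 0 := by
  simp only [secondVar, inv_one, Matrix.one_mul, Matrix.neg_mul, Matrix.mul_neg, neg_neg, sub_self]

/-- [folklore] non-degeneracy of the zeroth jet: `det 1 ≠ 0`. -/
theorem det_expJet₀_ne_zero : (1 : Matrix ι ι ℝ).det ≠ 0 := by
  rw [Matrix.det_one]; exact one_ne_zero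

end Group

/-! ## §2 (T-β-4) from FIRST-ORDER intertwining: the moved-slice Faddeev–Popov 2-jet of an exponential transport vanishes -/

section Intertwine

variable {ν ρ : Type*} [Fintype ν] [Fintype ρ] [DecidableEq ρ]

/-- [folklore] **THE MOVED-SLICE FADDEEV–POPOV 2-JET VANISHES UNDER SLICED INTERTWINING.**  Static slice rows `τ`, static generator `W₀` with
`det(τ·W₀) ≠ 0`; if the transport generator `X` intertwines the gauge modes AFTER SLICING — `τ·X·W₀ = τ·W₀·Z` and `τ·(X·X)·W₀ = τ·W₀·(Z·Z)` for some
`Z` on the parameters — then the Faddeev–Popov 2-jet of the slice moved by the inverse exponential jet `(τ, τ·(−X), τ·(X·X))` against `W₀` is zero: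
`secondVar (τ·W₀) (τ·(−X)·W₀) (τ·(X·X)·W₀) = secondVar (τW₀) 0 0 + secondVar 1 (−Z) (Z·Z) = 0` (`secondVar_mul₂`). -/
theorem secondVar_movedSlice_expJet_eq_zero_of_sliced (τ : Matrix ρ ν ℝ) (W₀ : Matrix ν ρ ℝ) (X : Matrix ν ν ℝ) (Z : Matrix ρ ρ ℝ)
    (hτ : (τ * W₀).det ≠ 0) (h1 : τ * X * W₀ = τ * W₀ * Z) (h2 : τ * (X * X) * W₀ = τ * W₀ * (Z * Z)) :
    secondVar (τ * W₀) (τ * (-X) * W₀) (τ * (X * X) * W₀) = 0 := by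
  have e1 : τ * (-X) * W₀ = τ * W₀ * (-Z) := by
    rw [Matrix.mul_neg, Matrix.neg_mul, h1, Matrix.mul_neg]
  have h := secondVar_mul₂ (τ * W₀) 0 0 (1 : Matrix ρ ρ ℝ) (-Z) (Z * Z) hτ det_expJet₀_ne_zero
  simp only [Matrix.zero_mul, zero_add, Matrix.mul_one, secondVar_zero_jets, secondVar_expJet_neg, add_zero] at h
  rw [e1, h2]
  exact h

/-- [folklore] **(T-β-4) ⟸ FIRST-ORDER INTERTWINING**: if the transport generator preserves the gauge-mode subspace, `X·W₀ = W₀·Z`, then for every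
static slice `τ` with `det(τ·W₀) ≠ 0` the moved-slice Faddeev–Popov 2-jet vanishes: `secondVar (τ·W₀) (τ·(−X)·W₀) (τ·(X·X)·W₀) = 0` —
the clause «`Bₙ·W₀ = W₀·Cₙ` with `secondVar C-jets = 0`» of memo §23 (23b) with `C = (1, −Z, Z·Z)` AUTOMATICALLY unimodular. -/
theorem secondVar_movedSlice_expJet_eq_zero (τ : Matrix ρ ν ℝ) (W₀ : Matrix ν ρ ℝ) (X : Matrix ν ν ℝ) (Z : Matrix ρ ρ ℝ)
    (hτ : (τ * W₀).det ≠ 0) (hX : X * W₀ = W₀ * Z) :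
    secondVar (τ * W₀) (τ * (-X) * W₀) (τ * (X * X) * W₀) = 0 := by
  have hXX : X * X * W₀ = W₀ * (Z * Z) := by
    rw [Matrix.mul_assoc, hX, ← Matrix.mul_assoc, hX, Matrix.mul_assoc]
  exact secondVar_movedSlice_expJet_eq_zero_of_sliced τ W₀ X Z hτ
    (by rw [Matrix.mul_assoc, hX, ← Matrix.mul_assoc]) (by rw [Matrix.mul_assoc, hXX, ← Matrix.mul_assoc])

/-- [folklore] **MOVING GENERATOR: THE MOVED-SLICE FADDEEV–POPOV 2-JET EQUALS THE UNMOVED ONE** if the transport generator intertwines the generator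
JETS to first order, `X·W₀ = W₀·Z` and `X·W₁ = W₁·Z`: with the slice moved by the inverse exponential jet `(τ, τ·(−X), τ·(X·X))`, the Faddeev–Popov 2-jet
of `SliceExchangeJets.secondVar_kkt_slice_change_jets_of_range` (`T₁W₀ + T₀W₁`, `T₂W₀ + T₁W₁ + (T₁W₁ + T₀W₂)`) is the product 2-jet `(τ·W)·(1, −Z, Z·Z)`,
so `secondVar` (moved) `= secondVar (τW₀) (τW₁) (τW₂) + secondVar 1 (−Z) (Z·Z) = secondVar` (unmoved). -/
theorem secondVar_movedSlice_expJet_eq (τ : Matrix ρ ν ℝ) (W₀ W₁ W₂ : Matrix ν ρ ℝ) (X : Matrix ν ν ℝ) (Z : Matrix ρ ρ ℝ)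
    (hτ : (τ * W₀).det ≠ 0) (hX₀ : X * W₀ = W₀ * Z) (hX₁ : X * W₁ = W₁ * Z) :
    secondVar (τ * W₀) (τ * (-X) * W₀ + τ * W₁) (τ * (X * X) * W₀ + τ * (-X) * W₁ + (τ * (-X) * W₁ + τ * W₂))
      = secondVar (τ * W₀) (τ * W₁) (τ * W₂) := by
  have hXX : X * X * W₀ = W₀ * (Z * Z) := by
    rw [Matrix.mul_assoc, hX₀, ← Matrix.mul_assoc, hX₀, Matrix.mul_assoc]
  have e0 : τ * (-X) * W₀ = τ * W₀ * (-Z) := by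
    rw [Matrix.mul_neg, Matrix.neg_mul, Matrix.mul_assoc, hX₀, ← Matrix.mul_assoc, Matrix.mul_neg]
  have e1 : τ * (-X) * W₁ = τ * W₁ * (-Z) := by
    rw [Matrix.mul_neg, Matrix.neg_mul, Matrix.mul_assoc, hX₁, ← Matrix.mul_assoc, Matrix.mul_neg]
  have e2 : τ * (X * X) * W₀ = τ * W₀ * (Z * Z) := by
    rw [Matrix.mul_assoc, hXX, ← Matrix.mul_assoc]
  have h := secondVar_mul₂ (τ * W₀) (τ * W₁) (τ * W₂) (1 : Matrix ρ ρ ℝ) (-Z) (Z * Z) hτ det_expJet₀_ne_zero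
  rw [Matrix.mul_one, Matrix.mul_one, Matrix.mul_one, secondVar_expJet_neg, add_zero] at h
  rw [e0, e1, e2, add_comm (τ * W₀ * -Z) (τ * W₁),
    show τ * W₀ * (Z * Z) + τ * W₁ * -Z + (τ * W₁ * -Z + τ * W₂) = τ * W₂ + τ * W₁ * -Z + (τ * W₁ * -Z + τ * W₀ * (Z * Z)) by abel]
  exact h

/-- [folklore] **GENERIC TRANSPORT: THE MOVED-SLICE FADDEEV–POPOV 2-JET UNDER THE INTERTWINING LETTERS** (memo §23 (23b) (T-β-4) verbatim: «`Bₙ·W-jets = W-jets·Cₙ`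
with `secondVar C-jets = 0`»).  For ANY slice-transport 2-jet `(B₀, B₁, B₂)` and generator jets `(W₀, W₁, W₂)`: if the product jets intertwine,
`i0 : B₀W₀ = W₀C₀`, `i1 : B₁W₀ + B₀W₁ = W₁C₀ + W₀C₁`, `i2 : B₂W₀ + 2•(B₁W₁) + B₀W₂ = W₂C₀ + 2•(W₁C₁) + W₀C₂`, with `det C₀ ≠ 0`, then the Faddeev–Popov 2-jet of
the moved slice `T := (τB₀, τB₁, τB₂)` (`SliceExchangeJets`' words `T₁W₀ + T₀W₁`, `T₂W₀ + T₁W₁ + (T₁W₁ + T₀W₂)`) is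
`secondVar (τW₀) (τW₁) (τW₂) + secondVar C₀ C₁ C₂` (`secondVar_mul₂`). -/
theorem secondVar_movedSlice_eq_add_of_intertwine (τ : Matrix ρ ν ℝ) (W₀ W₁ W₂ : Matrix ν ρ ℝ) (B₀ B₁ B₂ : Matrix ν ν ℝ) (C₀ C₁ C₂ : Matrix ρ ρ ℝ)
    (hτ : (τ * W₀).det ≠ 0) (hC : C₀.det ≠ 0)
    (i0 : B₀ * W₀ = W₀ * C₀) (i1 : B₁ * W₀ + B₀ * W₁ = W₁ * C₀ + W₀ * C₁)
    (i2 : B₂ * W₀ + (2 : ℝ) • (B₁ * W₁) + B₀ * W₂ = W₂ * C₀ + (2 : ℝ) • (W₁ * C₁) + W₀ * C₂) :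
    secondVar (τ * B₀ * W₀) (τ * B₁ * W₀ + τ * B₀ * W₁) (τ * B₂ * W₀ + τ * B₁ * W₁ + (τ * B₁ * W₁ + τ * B₀ * W₂))
      = secondVar (τ * W₀) (τ * W₁) (τ * W₂) + secondVar C₀ C₁ C₂ := by
  have e0 : τ * B₀ * W₀ = τ * W₀ * C₀ := by rw [Matrix.mul_assoc, i0, ← Matrix.mul_assoc]
  have e1 : τ * B₁ * W₀ + τ * B₀ * W₁ = τ * W₁ * C₀ + τ * W₀ * C₁ := by
    have h := congrArg (fun M => τ * M) i1
    simp only [Matrix.mul_add, ← Matrix.mul_assoc] at h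
    exact h
  have e2 : τ * B₂ * W₀ + τ * B₁ * W₁ + (τ * B₁ * W₁ + τ * B₀ * W₂) = τ * W₂ * C₀ + τ * W₁ * C₁ + (τ * W₁ * C₁ + τ * W₀ * C₂) := by
    have h := congrArg (fun M => τ * M) i2
    simp only [Matrix.mul_add, two_smul, ← Matrix.mul_assoc] at h
    calc τ * B₂ * W₀ + τ * B₁ * W₁ + (τ * B₁ * W₁ + τ * B₀ * W₂)
        = τ * B₂ * W₀ + (τ * B₁ * W₁ + τ * B₁ * W₁) + τ * B₀ * W₂ := by abel
      _ = τ * W₂ * C₀ + (τ * W₁ * C₁ + τ * W₁ * C₁) + τ * W₀ * C₂ := h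
      _ = τ * W₂ * C₀ + τ * W₁ * C₁ + (τ * W₁ * C₁ + τ * W₀ * C₂) := by abel
  rw [e0, e1, e2]
  exact secondVar_mul₂ (τ * W₀) (τ * W₁) (τ * W₂) C₀ C₁ C₂ hτ hC

/-- [folklore] **… hence EQUAL to the unmoved one when the intertwiner is unimodular at jet level** (`uC : secondVar C₀ C₁ C₂ = 0`). -/
theorem secondVar_movedSlice_eq_of_intertwine (τ : Matrix ρ ν ℝ) (W₀ W₁ W₂ : Matrix ν ρ ℝ) (B₀ B₁ B₂ : Matrix ν ν ℝ) (C₀ C₁ C₂ : Matrix ρ ρ ℝ)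
    (hτ : (τ * W₀).det ≠ 0) (hC : C₀.det ≠ 0)
    (i0 : B₀ * W₀ = W₀ * C₀) (i1 : B₁ * W₀ + B₀ * W₁ = W₁ * C₀ + W₀ * C₁)
    (i2 : B₂ * W₀ + (2 : ℝ) • (B₁ * W₁) + B₀ * W₂ = W₂ * C₀ + (2 : ℝ) • (W₁ * C₁) + W₀ * C₂) (uC : secondVar C₀ C₁ C₂ = 0) :
    secondVar (τ * B₀ * W₀) (τ * B₁ * W₀ + τ * B₀ * W₁) (τ * B₂ * W₀ + τ * B₁ * W₁ + (τ * B₁ * W₁ + τ * B₀ * W₂))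
      = secondVar (τ * W₀) (τ * W₁) (τ * W₂) := by
  rw [secondVar_movedSlice_eq_add_of_intertwine τ W₀ W₁ W₂ B₀ B₁ B₂ C₀ C₁ C₂ hτ hC i0 i1 i2, uC, add_zero]

end Intertwine

/-! ## §3 THE UN-MOVE (static frame of record): the sliced 2-jet with the slice moved by the inverse exponential jet has the `secondVar` of the
sliced 2-jet with the static slice -/

section Unmove

variable {ν μ ρ : Type*} [Fintype ν] [Fintype μ] [Fintype ρ] [DecidableEq ν] [DecidableEq μ] [DecidableEq ρ]

/-- [folklore] **THE UN-MOVE, SLICED INTERTWINING.**  Sliced bordered 2-jets `(K₀,K₁,K₂)`, `(Q₀,Q₁,Q₂)` with the RELAXED Ward letters of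
`SliceExchangeJets.secondVar_kkt_slice_change_jets_of_range` for a STATIC generator `W₀` (`W₁ = W₂ = 0`: `Kₙ·W₀ = Σ 𝑸ᵀY`-words, the same for `Kₙᵀ`
with `Y′`, `Qₙ·W₀ = 0`), a static slice `τ` with `det(τ·W₀) ≠ 0` and `det (kkt K₀ [Q₀; τ]) ≠ 0`, and a transport generator `X` intertwining the gauge
modes after slicing (`τ·X·W₀ = τ·W₀·Z`, `τ·(X·X)·W₀ = τ·W₀·(Z·Z)`): moving the slice by the inverse exponential jet costs NOTHING —
`secondVar (kkt K₀ [Q₀; τ]) (kkt K₁ [Q₁; τ·(−X)]) (kkt K₂ [Q₂; τ·(X·X)]) = secondVar (kkt K₀ [Q₀; τ]) (kkt K₁ [Q₁; 0]) (kkt K₂ [Q₂; 0])`. -/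
theorem secondVar_kkt_unmove_expJet_of_sliced (K₀ K₁ K₂ : Matrix ν ν ℝ) (Q₀ Q₁ Q₂ : Matrix μ ν ℝ) (τ : Matrix ρ ν ℝ) (W₀ : Matrix ν ρ ℝ)
    (X : Matrix ν ν ℝ) (Z : Matrix ρ ρ ℝ) (Y₀ Y₁ Y₂ Y'₀ Y'₁ Y'₂ : Matrix μ ρ ℝ)
    (a0 : K₀ * W₀ = Q₀ᵀ * Y₀) (a1 : K₁ * W₀ = Q₁ᵀ * Y₀ + Q₀ᵀ * Y₁) (a2 : K₂ * W₀ = Q₂ᵀ * Y₀ + (2 : ℝ) • (Q₁ᵀ * Y₁) + Q₀ᵀ * Y₂)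
    (a0t : K₀ᵀ * W₀ = Q₀ᵀ * Y'₀) (a1t : K₁ᵀ * W₀ = Q₁ᵀ * Y'₀ + Q₀ᵀ * Y'₁) (a2t : K₂ᵀ * W₀ = Q₂ᵀ * Y'₀ + (2 : ℝ) • (Q₁ᵀ * Y'₁) + Q₀ᵀ * Y'₂)
    (b0 : Q₀ * W₀ = 0) (b1 : Q₁ * W₀ = 0) (b2 : Q₂ * W₀ = 0)
    (hτ : (τ * W₀).det ≠ 0) (h0 : (kkt K₀ (fromRows Q₀ τ)).det ≠ 0)
    (h1 : τ * X * W₀ = τ * W₀ * Z) (h2 : τ * (X * X) * W₀ = τ * W₀ * (Z * Z)) :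
    secondVar (kkt K₀ (fromRows Q₀ τ)) (kkt K₁ (fromRows Q₁ (τ * (-X)))) (kkt K₂ (fromRows Q₂ (τ * (X * X))))
      = secondVar (kkt K₀ (fromRows Q₀ τ)) (kkt K₁ (fromRows Q₁ (0 : Matrix ρ ν ℝ))) (kkt K₂ (fromRows Q₂ (0 : Matrix ρ ν ℝ))) := by
  -- the slice exchange from 2-jets, static `P := τ` against the moving `T := (τ, τ·(−X), τ·(X·X))`, generator jets `(W₀, 0, 0)`
  have h := secondVar_kkt_slice_change_jets_of_range K₀ K₁ K₂ Q₀ Q₁ Q₂ τ (τ * (-X)) (τ * (X * X)) τ W₀ 0 0 Y₀ Y₁ Y₂ Y'₀ Y'₁ Y'₂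
    a0 (by rw [Matrix.mul_zero, add_zero]; exact a1) (by rw [Matrix.mul_zero, Matrix.mul_zero, smul_zero, add_zero, add_zero]; exact a2)
    a0t (by rw [Matrix.mul_zero, add_zero]; exact a1t) (by rw [Matrix.mul_zero, Matrix.mul_zero, smul_zero, add_zero, add_zero]; exact a2t)
    b0 (by rw [Matrix.mul_zero, add_zero]; exact b1) (by rw [Matrix.mul_zero, Matrix.mul_zero, smul_zero, add_zero, add_zero]; exact b2)
    hτ hτ h0
  -- both Faddeev–Popov 2-jets vanish: the static one trivially, the moved one by §2
  have hfp := secondVar_movedSlice_expJet_eq_zero_of_sliced τ W₀ X Z hτ h1 h2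
  simp only [Matrix.mul_assoc] at hfp
  simp only [Matrix.mul_zero, add_zero, secondVar_zero_jets, Matrix.mul_assoc, hfp, mul_zero, sub_self] at h
  exact h.symm

/-- [folklore] **THE UN-MOVE** under honest first-order intertwining `X·W₀ = W₀·Z`: as `secondVar_kkt_unmove_expJet_of_sliced`. -/
theorem secondVar_kkt_unmove_expJet (K₀ K₁ K₂ : Matrix ν ν ℝ) (Q₀ Q₁ Q₂ : Matrix μ ν ℝ) (τ : Matrix ρ ν ℝ) (W₀ : Matrix ν ρ ℝ)
    (X : Matrix ν ν ℝ) (Z : Matrix ρ ρ ℝ) (Y₀ Y₁ Y₂ Y'₀ Y'₁ Y'₂ : Matrix μ ρ ℝ)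
    (a0 : K₀ * W₀ = Q₀ᵀ * Y₀) (a1 : K₁ * W₀ = Q₁ᵀ * Y₀ + Q₀ᵀ * Y₁) (a2 : K₂ * W₀ = Q₂ᵀ * Y₀ + (2 : ℝ) • (Q₁ᵀ * Y₁) + Q₀ᵀ * Y₂)
    (a0t : K₀ᵀ * W₀ = Q₀ᵀ * Y'₀) (a1t : K₁ᵀ * W₀ = Q₁ᵀ * Y'₀ + Q₀ᵀ * Y'₁) (a2t : K₂ᵀ * W₀ = Q₂ᵀ * Y'₀ + (2 : ℝ) • (Q₁ᵀ * Y'₁) + Q₀ᵀ * Y'₂)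
    (b0 : Q₀ * W₀ = 0) (b1 : Q₁ * W₀ = 0) (b2 : Q₂ * W₀ = 0)
    (hτ : (τ * W₀).det ≠ 0) (h0 : (kkt K₀ (fromRows Q₀ τ)).det ≠ 0) (hX : X * W₀ = W₀ * Z) :
    secondVar (kkt K₀ (fromRows Q₀ τ)) (kkt K₁ (fromRows Q₁ (τ * (-X)))) (kkt K₂ (fromRows Q₂ (τ * (X * X))))
      = secondVar (kkt K₀ (fromRows Q₀ τ)) (kkt K₁ (fromRows Q₁ (0 : Matrix ρ ν ℝ))) (kkt K₂ (fromRows Q₂ (0 : Matrix ρ ν ℝ))) := by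
  have hXX : X * X * W₀ = W₀ * (Z * Z) := by
    rw [Matrix.mul_assoc, hX, ← Matrix.mul_assoc, hX, Matrix.mul_assoc]
  exact secondVar_kkt_unmove_expJet_of_sliced K₀ K₁ K₂ Q₀ Q₁ Q₂ τ W₀ X Z Y₀ Y₁ Y₂ Y'₀ Y'₁ Y'₂ a0 a1 a2 a0t a1t a2t b0 b1 b2 hτ h0
    (by rw [Matrix.mul_assoc, hX, ← Matrix.mul_assoc]) (by rw [Matrix.mul_assoc, hXX, ← Matrix.mul_assoc])

/-- [folklore] **THE UN-MOVE, MOVING GENERATOR.**  As `secondVar_kkt_unmove_expJet`, with generator JETS `(W₀, W₁, W₂)` and the slice-exchange letters of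
`SliceExchangeJets.secondVar_kkt_slice_change_jets_of_range` VERBATIM (`a0 a1 a2 a0t a1t a2t b0 b1 b2 hP∕hT h0` at `P := τ`): if the transport generator
intertwines the generator jets to first order, `X·W₀ = W₀·Z`, `X·W₁ = W₁·Z`, then moving the slice by the inverse exponential jet costs NOTHING:
`secondVar (kkt K₀ [Q₀; τ]) (kkt K₁ [Q₁; τ·(−X)]) (kkt K₂ [Q₂; τ·(X·X)]) = secondVar (kkt K₀ [Q₀; τ]) (kkt K₁ [Q₁; 0]) (kkt K₂ [Q₂; 0])`. -/
theorem secondVar_kkt_unmove_expJet_moving (K₀ K₁ K₂ : Matrix ν ν ℝ) (Q₀ Q₁ Q₂ : Matrix μ ν ℝ) (τ : Matrix ρ ν ℝ) (W₀ W₁ W₂ : Matrix ν ρ ℝ)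
    (X : Matrix ν ν ℝ) (Z : Matrix ρ ρ ℝ) (Y₀ Y₁ Y₂ Y'₀ Y'₁ Y'₂ : Matrix μ ρ ℝ)
    (a0 : K₀ * W₀ = Q₀ᵀ * Y₀) (a1 : K₁ * W₀ + K₀ * W₁ = Q₁ᵀ * Y₀ + Q₀ᵀ * Y₁)
    (a2 : K₂ * W₀ + (2 : ℝ) • (K₁ * W₁) + K₀ * W₂ = Q₂ᵀ * Y₀ + (2 : ℝ) • (Q₁ᵀ * Y₁) + Q₀ᵀ * Y₂)
    (a0t : K₀ᵀ * W₀ = Q₀ᵀ * Y'₀) (a1t : K₁ᵀ * W₀ + K₀ᵀ * W₁ = Q₁ᵀ * Y'₀ + Q₀ᵀ * Y'₁)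
    (a2t : K₂ᵀ * W₀ + (2 : ℝ) • (K₁ᵀ * W₁) + K₀ᵀ * W₂ = Q₂ᵀ * Y'₀ + (2 : ℝ) • (Q₁ᵀ * Y'₁) + Q₀ᵀ * Y'₂)
    (b0 : Q₀ * W₀ = 0) (b1 : Q₁ * W₀ + Q₀ * W₁ = 0) (b2 : Q₂ * W₀ + (2 : ℝ) • (Q₁ * W₁) + Q₀ * W₂ = 0)
    (hτ : (τ * W₀).det ≠ 0) (h0 : (kkt K₀ (fromRows Q₀ τ)).det ≠ 0) (hX₀ : X * W₀ = W₀ * Z) (hX₁ : X * W₁ = W₁ * Z) :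
    secondVar (kkt K₀ (fromRows Q₀ τ)) (kkt K₁ (fromRows Q₁ (τ * (-X)))) (kkt K₂ (fromRows Q₂ (τ * (X * X))))
      = secondVar (kkt K₀ (fromRows Q₀ τ)) (kkt K₁ (fromRows Q₁ (0 : Matrix ρ ν ℝ))) (kkt K₂ (fromRows Q₂ (0 : Matrix ρ ν ℝ))) := by
  have h := secondVar_kkt_slice_change_jets_of_range K₀ K₁ K₂ Q₀ Q₁ Q₂ τ (τ * (-X)) (τ * (X * X)) τ W₀ W₁ W₂ Y₀ Y₁ Y₂ Y'₀ Y'₁ Y'₂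
    a0 a1 a2 a0t a1t a2t b0 b1 b2 hτ hτ h0
  have hfp := secondVar_movedSlice_expJet_eq τ W₀ W₁ W₂ X Z hτ hX₀ hX₁
  simp only [Matrix.mul_assoc] at hfp
  simp only [Matrix.mul_assoc, hfp, sub_self, add_zero] at h
  exact h.symm

/-- [folklore] **THE UN-MOVE, GENERIC TRANSPORT** (memo §23 (23b) (T-β-4) as letters).  Sliced bordered 2-jets `(Kₙ)`, `(Qₙ)` with the slice-exchange letters of
`SliceExchangeJets.secondVar_kkt_slice_change_jets_of_range` VERBATIM at `P := τ` (generator jets `W₀ W₁ W₂`), a slice-transport 2-jet `(B₀, B₁, B₂)` with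
`det (τB₀W₀) ≠ 0` and `det (kkt K₀ [Q₀; τB₀]) ≠ 0`, and the INTERTWINING LETTERS `i0 i1 i2` with a jet-level unimodular intertwiner (`uC`, `det C₀ ≠ 0`): moving the
slice costs nothing — `secondVar (kkt K₀ [Q₀; τ]) (kkt K₁ [Q₁; 0]) (kkt K₂ [Q₂; 0]) = secondVar (kkt K₀ [Q₀; τB₀]) (kkt K₁ [Q₁; τB₁]) (kkt K₂ [Q₂; τB₂])`. -/
theorem secondVar_kkt_unmove_of_intertwine (K₀ K₁ K₂ : Matrix ν ν ℝ) (Q₀ Q₁ Q₂ : Matrix μ ν ℝ) (τ : Matrix ρ ν ℝ) (W₀ W₁ W₂ : Matrix ν ρ ℝ)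
    (B₀ B₁ B₂ : Matrix ν ν ℝ) (C₀ C₁ C₂ : Matrix ρ ρ ℝ) (Y₀ Y₁ Y₂ Y'₀ Y'₁ Y'₂ : Matrix μ ρ ℝ)
    (a0 : K₀ * W₀ = Q₀ᵀ * Y₀) (a1 : K₁ * W₀ + K₀ * W₁ = Q₁ᵀ * Y₀ + Q₀ᵀ * Y₁)
    (a2 : K₂ * W₀ + (2 : ℝ) • (K₁ * W₁) + K₀ * W₂ = Q₂ᵀ * Y₀ + (2 : ℝ) • (Q₁ᵀ * Y₁) + Q₀ᵀ * Y₂)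
    (a0t : K₀ᵀ * W₀ = Q₀ᵀ * Y'₀) (a1t : K₁ᵀ * W₀ + K₀ᵀ * W₁ = Q₁ᵀ * Y'₀ + Q₀ᵀ * Y'₁)
    (a2t : K₂ᵀ * W₀ + (2 : ℝ) • (K₁ᵀ * W₁) + K₀ᵀ * W₂ = Q₂ᵀ * Y'₀ + (2 : ℝ) • (Q₁ᵀ * Y'₁) + Q₀ᵀ * Y'₂)
    (b0 : Q₀ * W₀ = 0) (b1 : Q₁ * W₀ + Q₀ * W₁ = 0) (b2 : Q₂ * W₀ + (2 : ℝ) • (Q₁ * W₁) + Q₀ * W₂ = 0)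
    (hτ : (τ * W₀).det ≠ 0) (hτB : (τ * B₀ * W₀).det ≠ 0) (h0 : (kkt K₀ (fromRows Q₀ (τ * B₀))).det ≠ 0) (hC : C₀.det ≠ 0)
    (i0 : B₀ * W₀ = W₀ * C₀) (i1 : B₁ * W₀ + B₀ * W₁ = W₁ * C₀ + W₀ * C₁)
    (i2 : B₂ * W₀ + (2 : ℝ) • (B₁ * W₁) + B₀ * W₂ = W₂ * C₀ + (2 : ℝ) • (W₁ * C₁) + W₀ * C₂) (uC : secondVar C₀ C₁ C₂ = 0) :
    secondVar (kkt K₀ (fromRows Q₀ τ)) (kkt K₁ (fromRows Q₁ (0 : Matrix ρ ν ℝ))) (kkt K₂ (fromRows Q₂ (0 : Matrix ρ ν ℝ)))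
      = secondVar (kkt K₀ (fromRows Q₀ (τ * B₀))) (kkt K₁ (fromRows Q₁ (τ * B₁))) (kkt K₂ (fromRows Q₂ (τ * B₂))) := by
  have h := secondVar_kkt_slice_change_jets_of_range K₀ K₁ K₂ Q₀ Q₁ Q₂ (τ * B₀) (τ * B₁) (τ * B₂) τ W₀ W₁ W₂ Y₀ Y₁ Y₂ Y'₀ Y'₁ Y'₂
    a0 a1 a2 a0t a1t a2t b0 b1 b2 hτ hτB h0
  have hfp := secondVar_movedSlice_eq_of_intertwine τ W₀ W₁ W₂ B₀ B₁ B₂ C₀ C₁ C₂ hτ hC i0 i1 i2 uC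
  simp only [Matrix.mul_assoc] at hfp
  simp only [Matrix.mul_assoc, hfp, sub_self, add_zero] at h
  simpa only [Matrix.mul_assoc] using h

end Unmove

end Summit.QuantumFields.BalabanUV.Beta.FP.ExponentialTransportJets

end
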